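import Mathlib
import HarnessLib
import Summits.HubbardSuperconductivity.HubbardSuperconductivity.Theses.EnslavedA1g
import Literature.MathematicalPhysics.QuantumLattice.PairCorrelations

/-!
# Route `EnslavedA1g`, support `BondParallelogram` (item `stmt-HubbardSuperconductivity-0940`)

The PARALLELOGRAM IDENTITY of the route: on the fermionic torus of every side `L ≥ 1`,
`P_{s'}ᴴ P_{s'} + P_dᴴ P_d = 2 (P_hᴴ P_h + P_vᴴ P_v)`, where `P_{s'} = pairField extendedSWave L`,
`P_d = pairField dWaveFormFactor L` and `P_h`, `P_v` are the pair fields of the horizontal /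
vertical nearest-neighbour singlet bond form factors `(extendedSWave ± dWaveFormFactor)/2`.

Proof: `localPair g L x = Σ_e (g e/√2) • M_{x,e}` with `M` independent of `g`, so `localPair` and
`pairField` are additive in the form factor (`localPair_formFactor_add`,
`pairField_formFactor_add`, and the subtractive versions); hence `P_{s'} = P_h + P_v`,
`P_d = P_h - P_v` (`pairField_extendedSWave_eq_bond_add`, `pairField_dWaveFormFactor_eq_bond_sub`),
and the identity is the operator parallelogram law
`(A+B)ᴴ(A+B) + (A-B)ᴴ(A-B) = 2(AᴴA + BᴴB)` (`conjTranspose_mul_parallelogram`).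
No anticommutation relation and no hypothesis on `L` is used.

Source for the objects: D. J. Scalapino, Phys. Rep. 250 (1995) 329, §2 (form factors, pair
fields). The identity itself is elementary linear algebra.
-/

noncomputable section

namespace Summit.HubbardSuperconductivity.EnslavedA1g

open Matrix Finset
open Literature.Probability.LatticeModels Literature.MathematicalPhysics.QuantumLattice
open Summit.HubbardSuperconductivity.HubbardSuperconductivity.Theses.EnslavedA1g

/-! ### Linearity of the local pair operator and of the pair field in the form factor -/

section FormFactorLinearity

variable (g₁ g₂ : Site 2 → ℝ) (L : ℕ) [NeZero L]

/-- The local singlet pair operator is additive in the form factor: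
`P_x[g₁ + g₂] = P_x[g₁] + P_x[g₂]` (each summand of `localPair` is `(g e/√2) • M_{x,e}` with
`M_{x,e}` independent of `g`). Scalapino, Phys. Rep. 250 (1995) 329, §2. [folklore] -/
theorem localPair_formFactor_add (x : TorusSite 2 L) :
    localPair (fun e => g₁ e + g₂ e) L x = localPair g₁ L x + localPair g₂ L x := by
  unfold localPair
  rw [← Finset.sum_add_distrib]
  refine Finset.sum_congr rfl fun e _ => ?_
  rw [← add_smul]
  congr 1
  push_cast
  ring

/-- The local singlet pair operator is subtractive in the form factor:
`P_x[g₁ - g₂] = P_x[g₁] - P_x[g₂]`. Scalapino, Phys. Rep. 250 (1995) 329, §2. [folklore] -/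
theorem localPair_formFactor_sub (x : TorusSite 2 L) :
    localPair (fun e => g₁ e - g₂ e) L x = localPair g₁ L x - localPair g₂ L x := by
  unfold localPair
  rw [← Finset.sum_sub_distrib]
  refine Finset.sum_congr rfl fun e _ => ?_
  rw [← sub_smul]
  congr 1
  push_cast
  ring

/-- The pair field is additive in the form factor: `Δ[g₁ + g₂] = Δ[g₁] + Δ[g₂]`.
Scalapino, Phys. Rep. 250 (1995) 329, §2. [folklore] -/
theorem pairField_formFactor_add :
    pairField (fun e => g₁ e + g₂ e) L = pairField g₁ L + pairField g₂ L := by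
  unfold pairField
  rw [← Finset.sum_add_distrib]
  exact Finset.sum_congr rfl fun x _ => localPair_formFactor_add g₁ g₂ L x

/-- The pair field is subtractive in the form factor: `Δ[g₁ - g₂] = Δ[g₁] - Δ[g₂]`.
Scalapino, Phys. Rep. 250 (1995) 329, §2. [folklore] -/
theorem pairField_formFactor_sub :
    pairField (fun e => g₁ e - g₂ e) L = pairField g₁ L - pairField g₂ L := by
  unfold pairField
  rw [← Finset.sum_sub_distrib]
  exact Finset.sum_congr rfl fun x _ => localPair_formFactor_sub g₁ g₂ L x

end FormFactorLinearity

/-! ### The bond decomposition of the extended-`s` and `d`-wave pair fields -/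

section BondDecomposition

variable (L : ℕ) [NeZero L]

/-- `P_{s'} = P_h + P_v`: the extended-`s` pair field is the sum of the horizontal and vertical
bond pair fields, `P_h = Δ[(s' + d)/2]`, `P_v = Δ[(s' - d)/2]` (pointwise
`s' = (s' + d)/2 + (s' - d)/2`). Scalapino, Phys. Rep. 250 (1995) 329, §2. [folklore] -/
theorem pairField_extendedSWave_eq_bond_add :
    pairField extendedSWave L =
      pairField (fun e => (extendedSWave e + dWaveFormFactor e) / 2) L +
        pairField (fun e => (extendedSWave e - dWaveFormFactor e) / 2) L := by
  rw [← pairField_formFactor_add]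
  congr 1
  funext e
  ring

/-- `P_d = P_h - P_v`: the `d_{x²-y²}` pair field is the difference of the horizontal and
vertical bond pair fields (pointwise `d = (s' + d)/2 - (s' - d)/2`).
Scalapino, Phys. Rep. 250 (1995) 329, §2, eq. (2.3). [folklore] -/
theorem pairField_dWaveFormFactor_eq_bond_sub :
    pairField dWaveFormFactor L =
      pairField (fun e => (extendedSWave e + dWaveFormFactor e) / 2) L -
        pairField (fun e => (extendedSWave e - dWaveFormFactor e) / 2) L := by
  rw [← pairField_formFactor_sub]
  congr 1
  funext e
  ring

end BondDecomposition

/-! ### The operator parallelogram law and the route's identity -/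

/-- The parallelogram law for Gram operators of square complex matrices:
`(A + B)ᴴ (A + B) + (A - B)ᴴ (A - B) = 2 (Aᴴ A + Bᴴ B)` (the cross terms cancel). [folklore] -/
theorem conjTranspose_mul_parallelogram {n : Type*} [Fintype n]
    (A B : Matrix n n ℂ) :
    (A + B)ᴴ * (A + B) + (A - B)ᴴ * (A - B) = (2 : ℂ) • (Aᴴ * A + Bᴴ * B) := by
  rw [conjTranspose_add, conjTranspose_sub, two_smul]
  noncomm_ring

/-- **`BondParallelogram` (route `EnslavedA1g`, item 0940).** For every side `L ≥ 1`:
`P_{s'}ᴴ P_{s'} + P_dᴴ P_d = 2 (P_hᴴ P_h + P_vᴴ P_v)` with `P_{s'} = pairField extendedSWave L`,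
`P_d = pairField dWaveFormFactor L`, `P_h = pairField ((extendedSWave + dWaveFormFactor)/2) L`,
`P_v = pairField ((extendedSWave - dWaveFormFactor)/2) L`. Linearity of the pair field in the
form factor plus the operator parallelogram law; it turns the route's thesis into Scalapino's
`d`-wave order parameter, `⟨P_dᴴ P_d⟩ = 2(⟨P_hᴴ P_h⟩ + ⟨P_vᴴ P_v⟩) - ⟨P_{s'}ᴴ P_{s'}⟩`.
Scalapino, Phys. Rep. 250 (1995) 329, §2. [folklore] -/
theorem bondParallelogram_proof : BondParallelogram := by
  intro L _
  rw [pairField_extendedSWave_eq_bond_add L, pairField_dWaveFormFactor_eq_bond_sub L]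
  exact conjTranspose_mul_parallelogram _ _

end Summit.HubbardSuperconductivity.EnslavedA1g

end
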